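import Literature.NumberTheory.EllipticCurves.NewformGaloisRepModLOfPadicAlgClProofs
import Literature.NumberTheory.EllipticCurves.NewformGaloisRepOfRegularAlgebraicProofs
import HarnessLib

/-!
# Deligne–Serre 1974, Thm. 6.7 in weight one, closed modulo Harris–Lan–Taylor–Thorne's Thm. A
# and the adelic dictionary for eigenforms

A proofs-only file (theorems only; D-0026), written by the seat of the named fact
`Literature.NumberTheory.EllipticCurves.ModularForms.DeligneSerre1974.thm67_weightOne`, composing

* `thm67_weightOne_of_deligne_padicAlgCl'` (`NewformGaloisRepModLOfPadicAlgClProofs`): Thm. 6.7 in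
  weight one from Deligne's theorem (Deligne–Serre 1974, Thm. 6.1) in the `ℚ̄_ℓ`-form of the
  Langlands cone (for every `ι : ℚ̄_ℓ ≃+* ℂ` a semisimple `r : Gal(ℚ̄/ℚ) → GL₂(ℚ̄_ℓ)` with
  `det(X - r(Frob_p)) = X² - ι⁻¹(a_p) X + ι⁻¹(χ(p) p^{k-1})`, `p ∤ M ℓ`), and
* `deligne_padicAlgCl_of_theoremA_of_dictionary` / `…_of_langS27_of_dictionary`
  (`NewformGaloisRepOfRegularAlgebraicProofs`): that `ℚ̄_ℓ`-form from Harris–Lan–Taylor–Thorne's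
  Thm. A (existence; the tree's named fact `HarrisLanTaylorThorne2016.theoremA_existence`) resp.
  lang.S27 (`exists_galoisRep_of_regularAlgebraic`) and ONE hypothesis `hdict`, the adelic
  dictionary "eigenform of weight `≥ 2` ↦ regular algebraic cuspidal automorphic representation
  of `GL₂(𝔸_ℚ)` with Satake parameters `{(√p β_j)⁻¹}`" (Gelbart 1975, §3; Clozel 1990, §3.5),

so that the named fact `thm67_weightOne` is closed modulo `theoremA_existence` (a node of the
tree) and `hdict` (whose finite part the tree proves in `NewformAdelisation*`; the archimedean
half — the Harish-Chandra parameter of the representation generated by a holomorphic lift — is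
not yet in the tree).

## References

* P. Deligne, J.-P. Serre, *Formes modulaires de poids 1*, Ann. Sci. ÉNS (4) 7 (1974), Thm. 6.1,
  Thm. 6.7, 6.8–6.13, §8.2. [DeligneSerreASENS1974]
* M. Harris, K.-W. Lan, R. Taylor, J. Thorne, *On the rigid cohomology of certain Shimura
  varieties*, Res. Math. Sci. 3 (2016), Thm. A. [HarrisLanTaylorThorneRMS2016]
-/

noncomputable section

open scoped MatrixGroups ModularForm NumberField Polynomial

open CongruenceSubgroup IsDedekindDomain Polynomial Rat.HeightOneSpectrum
  Literature.NumberTheory.Automorphic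

namespace Literature.NumberTheory.EllipticCurves.ModularForms.DeligneSerre1974

variable {N : ℕ} [NeZero N]

/-- **Deligne–Serre 1974, Thm. 6.7 (weight one, `k_λ = 𝔽_ℓ`) modulo Harris–Lan–Taylor–Thorne's
Thm. A and the adelic dictionary.** `thm67_weightOne` follows from the existence half of
Harris–Lan–Taylor–Thorne's Thm. A (`hA`, named fact `HarrisLanTaylorThorne2016.theoremA_existence`),
the compactness fact `hcpt` of the `GL₂/ℚ` automorphy datum, and the dictionary `hdict`
(eigenform `g ∈ S_k(Γ₁(M), χ)`, `k ≥ 2` ↦ regular algebraic cuspidal `π` on `GL₂(𝔸_ℚ)` with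
Satake parameter `{(√p β₁)⁻¹, (√p β₂)⁻¹}` at `p ∤ M`, `β_j` the roots of `X² - a_p X + χ(p)p^{k-1}`):
`thm67_weightOne_of_deligne_padicAlgCl'` after `deligne_padicAlgCl_of_theoremA_of_dictionary`.
[cite: DeligneSerreASENS1974, Thm. 6.7 and Thm. 6.1] [cite: HarrisLanTaylorThorneRMS2016, Thm. A (p. 3)] -/
theorem thm67_weightOne_of_theoremA_of_dictionary
    (hA : HarrisLanTaylorThorne2016.theoremA_existence)
    (hcpt : isCompact_glFiniteIntegralLevel 2 ℚ)
    (hdict : ∀ (M : ℕ) [NeZero M] (k : ℤ), 2 ≤ k →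
      ∀ (g : CuspForm (Gamma1 M) k) (χ : DirichletCharacter ℂ M),
        g ∈ nebentypusSubspace M k χ → g ≠ 0 →
      ∀ (a : ℕ → ℂ),
        (∀ (p : ℕ) (hp : p.Prime), ¬ p ∣ M →
          (haveI : NeZero p := ⟨hp.ne_zero⟩; heckeT (Gamma1 M) k p g) = a p • g) →
      ∃ π : CuspidalAutomorphicRepData 2 ℚ hcpt, π.1.IsRegularAlgebraic ∧
        ∀ w : HeightOneSpectrum (𝓞 ℚ), ¬ ((primesEquiv w : Nat.Primes) : ℕ) ∣ M →
          π.1.HasSatakeParamAt w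
            ((X ^ 2 - C (a ((primesEquiv w : Nat.Primes) : ℕ)) * X +
                C (χ ((primesEquiv w : Nat.Primes) : ℕ) *
                  (((primesEquiv w : Nat.Primes) : ℕ) : ℂ) ^ (k - 1)) : ℂ[X]).roots.map
              fun β ↦ (((Real.sqrt ((primesEquiv w : Nat.Primes) : ℕ) : ℝ) : ℂ) * β)⁻¹)) :
    thm67_weightOne (N := N) :=
  thm67_weightOne_of_deligne_padicAlgCl'
    (fun M _ k hk g χ hg hg0 a haT ℓ _ ι ↦
      deligne_padicAlgCl_of_theoremA_of_dictionary hA hcpt hdict M k hk g χ hg hg0 a haT ℓ ι)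

/-- **Thm. 6.7 (weight one) modulo lang.S27 and the adelic dictionary**: as
`thm67_weightOne_of_theoremA_of_dictionary` with the tree's lang.S27
(`exists_galoisRep_of_regularAlgebraic`) in place of Thm. A.
[cite: DeligneSerreASENS1974, Thm. 6.7 and Thm. 6.1] [cite: HarrisLanTaylorThorneRMS2016, Thm. A (p. 3)] -/
theorem thm67_weightOne_of_langS27_of_dictionary
    (h27 : exists_galoisRep_of_regularAlgebraic)
    (hcpt : isCompact_glFiniteIntegralLevel 2 ℚ)
    (hdict : ∀ (M : ℕ) [NeZero M] (k : ℤ), 2 ≤ k →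
      ∀ (g : CuspForm (Gamma1 M) k) (χ : DirichletCharacter ℂ M),
        g ∈ nebentypusSubspace M k χ → g ≠ 0 →
      ∀ (a : ℕ → ℂ),
        (∀ (p : ℕ) (hp : p.Prime), ¬ p ∣ M →
          (haveI : NeZero p := ⟨hp.ne_zero⟩; heckeT (Gamma1 M) k p g) = a p • g) →
      ∃ π : CuspidalAutomorphicRepData 2 ℚ hcpt, π.1.IsRegularAlgebraic ∧
        ∀ w : HeightOneSpectrum (𝓞 ℚ), ¬ ((primesEquiv w : Nat.Primes) : ℕ) ∣ M →
          π.1.HasSatakeParamAt w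
            ((X ^ 2 - C (a ((primesEquiv w : Nat.Primes) : ℕ)) * X +
                C (χ ((primesEquiv w : Nat.Primes) : ℕ) *
                  (((primesEquiv w : Nat.Primes) : ℕ) : ℂ) ^ (k - 1)) : ℂ[X]).roots.map
              fun β ↦ (((Real.sqrt ((primesEquiv w : Nat.Primes) : ℕ) : ℝ) : ℂ) * β)⁻¹)) :
    thm67_weightOne (N := N) :=
  thm67_weightOne_of_deligne_padicAlgCl'
    (fun M _ k hk g χ hg hg0 a haT ℓ _ ι ↦
      deligne_padicAlgCl_of_langS27_of_dictionary h27 hcpt hdict M k hk g χ hg hg0 a haT ℓ ι)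

end Literature.NumberTheory.EllipticCurves.ModularForms.DeligneSerre1974
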